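import Summits.AtomisticToContinuum.FouriersLaw.Theorems.BondHeatUncertaintyExtensiveSnapshotIrreversibilityEnergyWindowScoreOrderOne
import Summits.AtomisticToContinuum.FouriersLaw.Theorems.BondHeatUncertaintyExtensiveSnapshotIrreversibilityEnergyWindowCostateObservability

/-!
# Bond heat uncertainty — addendum X-2C «WeightMomentsCoord»: the coordinate-generic order-1
  weight-moment leaf (RW₁ᶜ) `GramControlledWeightMomentsCoord` and (RW₁ᶜ) ⟹ (RW₁)

Cell `decomp-a2c`, lens «grading / quantitative ladder», generation 87 (critic row 1245 RULED (2):
«the prover seat's target is re-worded to the single coordinate-generic statement (RW₁ᶜ)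
`GramControlledWeightMomentsCoord` (`c : Fin N ⊕ Fin N`, rfl-compatible with (RW₁) at
`c = inr b`) — lens-1 TYPES (RW₁ᶜ) as one `def : Prop` + the rfl/mono lemma (RW₁ᶜ) ⟹ (RW₁),
nothing more»).

After parts X-1/X-2 the record beneath S3 is `(Dᵛ) ∧ (RW₁) ∧ (SD₁q)`: the momentum duals (SD₁)
come from (MC∞)✓ ∧ (RW₁) (part V), while the POSITION duals (SD₁q) (departure index `0`, arrival
index `1`) wait for the same Gram-conditional moment bound for the weights built from the
position coordinate `e_{q_b}` of the bath site instead of `e_{p_b}`.  This file types the ONE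
statement covering both:

* §1 the coordinate-generic regularised controls / fields / weights
  `skelCtrlArrC κ c = (Γ_m+κ)⁻¹ e_c`, `skelDepVecC c = coordV (∂_z E^s_{m,z}[ê_c])`
  (`ê_c = phaseDir c`: `inl i ↦ (e_i, 0)` = position `q_i`, `inr i ↦ (0, e_i)` = momentum `p_i`),
  `skelWeightArrC κ c = δ_m(Jᵀ(Γ_m+κ)⁻¹ e_c)`, `skelWeightDepC κ c = δ_m(Jᵀ(Γ_m+κ)⁻¹ V_c)` — at
  `c = inr b` these ARE the tree's `skelCtrlArr/skelDepVec/skelWeightArr/skelWeightDep` (`rfl`);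
* §2 ★ **(RW₁ᶜ) `GramControlledWeightMomentsCoord`**: the text of (RW₁)
  `GramControlledWeightMoments` (part U) with the two weights replaced by their coordinate-generic
  versions at `c ∈ {inl b, inr b}` for the bath site `b` (same quantifier order, same
  Gram-frame hypothesis, same conclusion shape), and ★ `gramControlledWeightMoments_of_coord :
  (RW₁ᶜ) → (RW₁)` (instantiate `c = inr b`; definitional).

No junction (RW₁ᶜ) ∧ (MC∞) ⟹ (SD₁q) is built here (DEFERRED by the ruling until (RW₁ᶜ) is
proved).  Only `def`/`theorem` declarations; no proof holes.  References: D. Nualart, *The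
Malliavin Calculus and Related Topics* (2006), Prop. 1.3.1, 1.5.4, 2.1.4; D. L. Burkholder,
Ann. Probab. 1 (1973), Thm 3.2; S. Kusuoka, D. Stroock, J. Fac. Sci. Univ. Tokyo 32 (1985),
Thm 2.19.
-/

noncomputable section

namespace Summit.AtomisticToContinuum.FouriersLaw.Theorems.ExtensiveSnapshotIrreversibility.EnergyWindow

open MeasureTheory ProbabilityTheory Filter Topology Real Set
open scoped ENNReal NNReal Matrix ContDiff
open Literature.MathematicalPhysics.KineticTheory.HeatConduction
open Literature.Probability.Process Literature.Analysis.ODE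

/-! ## 1. Coordinate-generic controls, fields and weights -/

section Objects

variable (ω₂ lam β γ : ℝ) (N : ℕ) (T_L T_R : ℝ) (s : ℝ) (m : ℕ)

/-- The phase-space direction of the coordinate `c`: `inl i ↦ (e_i, 0)` (position `q_i`),
`inr i ↦ (0, e_i)` (momentum `p_i`). [folklore] -/
def phaseDir (c : Fin N ⊕ Fin N) : PhaseSpace N :=
  Sum.elim (fun i => ((Pi.single i 1 : Fin N → ℝ), (0 : Fin N → ℝ)))
    (fun i => ((0 : Fin N → ℝ), (Pi.single i 1 : Fin N → ℝ))) c

/-- The **arrival control in coordinate `c`**: `a_c = (Γ + κ)⁻¹ e_c`. [folklore] -/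
def skelCtrlArrC (κ : ℝ) (c : Fin N ⊕ Fin N) (z : PhaseSpace N) (r : WienerPair)
    (x : PairSkeleton m) : Fin N ⊕ Fin N → ℝ :=
  regInv (skelGramAt ω₂ lam β γ N T_L T_R s m z r x) κ *ᵥ Pi.single c 1

/-- The arrival field `u_c = Jᵀ a_c`. [folklore] -/
def skelFieldArrC (κ : ℝ) (c : Fin N ⊕ Fin N) (z : PhaseSpace N) (r : WienerPair)
    (x : PairSkeleton m) : Fin (2 ^ m) ⊕ Fin (2 ^ m) → ℝ :=
  skelCtrlArrC ω₂ lam β γ N T_L T_R s m κ c z r x ᵥ* skelJacAt ω₂ lam β γ N T_L T_R s m z r x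

/-- The **departure vector in coordinate `c`**: the coordinates of `∂_z E^{s}_{m,z,r}(x)[ê_c]`.
[folklore] -/
def skelDepVecC (c : Fin N ⊕ Fin N) (z : PhaseSpace N) (r : WienerPair) (x : PairSkeleton m) :
    Fin N ⊕ Fin N → ℝ :=
  coordV N (fderiv ℝ (fun z' => skelFlowMapAt ω₂ lam β γ N T_L T_R s m z' r x) z (phaseDir N c))

/-- The departure control `a'_c = (Γ + κ)⁻¹ V_c`. [folklore] -/
def skelCtrlDepC (κ : ℝ) (c : Fin N ⊕ Fin N) (z : PhaseSpace N) (r : WienerPair)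
    (x : PairSkeleton m) : Fin N ⊕ Fin N → ℝ :=
  regInv (skelGramAt ω₂ lam β γ N T_L T_R s m z r x) κ *ᵥ
    skelDepVecC ω₂ lam β γ N T_L T_R s m c z r x

/-- The departure field `u'_c = Jᵀ a'_c`. [folklore] -/
def skelFieldDepC (κ : ℝ) (c : Fin N ⊕ Fin N) (z : PhaseSpace N) (r : WienerPair)
    (x : PairSkeleton m) : Fin (2 ^ m) ⊕ Fin (2 ^ m) → ℝ :=
  skelCtrlDepC ω₂ lam β γ N T_L T_R s m κ c z r x ᵥ* skelJacAt ω₂ lam β γ N T_L T_R s m z r x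

/-- The **regularised arrival weight in coordinate `c`**: `w_{m,κ,c} = δ_m(Jᵀ (Γ+κ)⁻¹ e_c)`.
[folklore] -/
def skelWeightArrC (κ : ℝ) (c : Fin N ⊕ Fin N) (z : PhaseSpace N) (r : WienerPair)
    (x : PairSkeleton m) : ℝ :=
  skelSkorokhod m (skelFieldArrC ω₂ lam β γ N T_L T_R s m κ c z r) x

/-- The **regularised departure weight in coordinate `c`**: `w'_{m,κ,c} = δ_m(Jᵀ (Γ+κ)⁻¹ V_c)`.
[folklore] -/
def skelWeightDepC (κ : ℝ) (c : Fin N ⊕ Fin N) (z : PhaseSpace N) (r : WienerPair)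
    (x : PairSkeleton m) : ℝ :=
  skelSkorokhod m (skelFieldDepC ω₂ lam β γ N T_L T_R s m κ c z r) x

end Objects

section Compat

variable {ω₂ lam β γ : ℝ} {N : ℕ} {T_L T_R : ℝ} {s : ℝ} {m : ℕ}

/-- `ê_{inr b} = (0, e_b)`. [folklore] -/
theorem phaseDir_inr (b : Fin N) :
    phaseDir N (Sum.inr b) = ((0 : Fin N → ℝ), (Pi.single b 1 : Fin N → ℝ)) := rfl

/-- `ê_{inl b} = (e_b, 0)`. [folklore] -/
theorem phaseDir_inl (b : Fin N) :
    phaseDir N (Sum.inl b) = ((Pi.single b 1 : Fin N → ℝ), (0 : Fin N → ℝ)) := rfl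

/-- At `c = inr b` the generic arrival control IS the tree's (`momCoord b = e_{inr b}`).
[folklore] -/
theorem skelCtrlArrC_inr (κ : ℝ) (b : Fin N) (z : PhaseSpace N) :
    skelCtrlArrC ω₂ lam β γ N T_L T_R s m κ (Sum.inr b) z =
      skelCtrlArr ω₂ lam β γ N T_L T_R s m κ b z := rfl

/-- At `c = inr b` the generic departure vector IS the tree's. [folklore] -/
theorem skelDepVecC_inr (b : Fin N) (z : PhaseSpace N) :
    skelDepVecC ω₂ lam β γ N T_L T_R s m (Sum.inr b) z =
      skelDepVec ω₂ lam β γ N T_L T_R s m b z := rfl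

/-- At `c = inr b` the generic arrival weight IS the tree's `skelWeightArr`. [folklore] -/
theorem skelWeightArrC_inr (κ : ℝ) (b : Fin N) (z : PhaseSpace N) :
    skelWeightArrC ω₂ lam β γ N T_L T_R s m κ (Sum.inr b) z =
      skelWeightArr ω₂ lam β γ N T_L T_R s m κ b z := rfl

/-- At `c = inr b` the generic departure weight IS the tree's `skelWeightDep`. [folklore] -/
theorem skelWeightDepC_inr (κ : ℝ) (b : Fin N) (z : PhaseSpace N) :
    skelWeightDepC ω₂ lam β γ N T_L T_R s m κ (Sum.inr b) z =
      skelWeightDep ω₂ lam β γ N T_L T_R s m κ b z := rfl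

end Compat

/-! ## 2. ★ (RW₁ᶜ) and (RW₁ᶜ) ⟹ (RW₁) -/

/-- ★ **(RW₁ᶜ) `GramControlledWeightMomentsCoord`** — the coordinate-generic order-1 skeleton
piece (OPEN · TRUE-leaning · ATTACKABLE-L; the prover seat's target after critic row 1245): the
text of (RW₁) `GramControlledWeightMoments` with the regularised arrival / departure weights taken
in the coordinate `c ∈ {inl b, inr b}` of the bath site `b` — `w_{m,κ,c} = δ_m(Jᵀ(Γ_m+κ)⁻¹e_c)`
and `w'_{m,κ,c} = δ_m(Jᵀ(Γ_m+κ)⁻¹ V_c)`, `V_c = ∂_z E^s_{m,z}[ê_c]` — same parameters `(q', ε',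
δ₀, K, μ)` depending on `(T, N, q, ε)` only, same Gram-frame minorant hypothesis on `Λ`, same
conclusion `skelMoment m q (w) ≤ (K (1 + C₁)^μ e^{εH(z)})^q` for both weights.  At `c = inr b` it
is (RW₁) verbatim (`gramControlledWeightMoments_of_coord`); at `c = inl b` it is the input of the
(deferred) position junction beneath (SD₁q).  WHY TRUE / WHY IT MIGHT FAIL: exactly as (RW₁) — the
expected proof (`‖(Γ_m+κ)⁻¹‖ ≤ Λ⁻¹` pathwise, Hölder, level-uniform Gaussian moments of the first
and second variation and of the Riemann–Itô sum `J x`) never uses which column `e_c` of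
`(Γ_m+κ)⁻¹` or which starting direction `ê_c` is taken; it could fail only through a
level-dependence of those `L^{2q}` norms.  NO Hörmander content (the `κ`-uniformity is (MC∞)'s).
[NEW · CONDITIONAL skeleton `L^q`-calculus · ATTACKABLE-L]
(after Nualart2006, Prop. 1.3.1, Prop. 1.5.4, Prop. 2.1.4) (after Burkholder1973, Thm 3.2) (after KusuokaStroock1985, Thm 2.19) [route leaf · named hypothesis of this cell, NOT filed as a route item here] -/
def GramControlledWeightMomentsCoord : Prop :=
  ∀ ω₂ lam β γ : ℝ, 0 < ω₂ → 0 < lam → 0 < β → 0 < γ →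
    ∀ T : ℝ, 0 < T → ∀ (N : ℕ) (hN : 2 ≤ N), ∀ q ε : ℝ, 1 < q → 0 < ε →
      ∃ (q' ε' δ₀ K : ℝ) (μ : ℕ), 0 < q' ∧ 0 < ε' ∧ 0 < δ₀ ∧ 0 ≤ K ∧
        ∀ C₁ : ℝ, 0 ≤ C₁ → ∀ δ : ℝ, |δ| < δ₀ → ∀ s : ℝ, 1 / 2 ≤ s → s ≤ 1 →
          ∀ b : Fin N, (b = leftBath N hN ∨ b = rightBath N hN) →
            ∀ c : Fin N ⊕ Fin N, (c = Sum.inl b ∨ c = Sum.inr b) → ∀ z : PhaseSpace N,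
            ∀ κ : ℝ, 0 < κ → ∀ (m : ℕ) (Λ : WienerPair → ℝ), Measurable Λ →
              (∀ (wp : WienerPair) (a : Fin N ⊕ Fin N → ℝ),
                Λ wp * (a ⬝ᵥ a) ≤
                  a ⬝ᵥ ((skelGramPath ω₂ lam β γ N (T + δ / 2) (T - δ / 2) s m z wp +
                    κ • (1 : Matrix (Fin N ⊕ Fin N) (Fin N ⊕ Fin N) ℝ)) *ᵥ a)) →
              ∫⁻ wp, (ENNReal.ofReal (Λ wp))⁻¹ ^ q' ∂wienerPair ≤
                ENNReal.ofReal ((C₁ * Real.exp (ε' * (pinnedChain ω₂ lam β γ).hamiltonian N z)) ^ q') →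
              skelMoment m q (skelWeightArrC ω₂ lam β γ N (T + δ / 2) (T - δ / 2) s m κ c z) ≤
                  ENNReal.ofReal ((K * (1 + C₁) ^ μ *
                    Real.exp (ε * (pinnedChain ω₂ lam β γ).hamiltonian N z)) ^ q) ∧
                skelMoment m q (skelWeightDepC ω₂ lam β γ N (T + δ / 2) (T - δ / 2) s m κ c z) ≤
                  ENNReal.ofReal ((K * (1 + C₁) ^ μ *
                    Real.exp (ε * (pinnedChain ω₂ lam β γ).hamiltonian N z)) ^ q)

/-- ★ **(RW₁ᶜ) ⟹ (RW₁)**: instantiate the coordinate at `c = inr b` (definitional). [folklore] -/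
theorem gramControlledWeightMoments_of_coord (h : GramControlledWeightMomentsCoord) :
    GramControlledWeightMoments := by
  intro ω₂ lam β γ hω hl hβ hγ T hT N hN q ε hq hε
  obtain ⟨q', ε', δ₀, K, μ, hq', hε', hδ₀, hK, hmain⟩ :=
    h ω₂ lam β γ hω hl hβ hγ T hT N hN q ε hq hε
  exact ⟨q', ε', δ₀, K, μ, hq', hε', hδ₀, hK,
    fun C₁ hC₁ δ hδ s hs hs1 b hb z κ hκ m Λ hΛ hfr hmo =>
      hmain C₁ hC₁ δ hδ s hs hs1 b hb (Sum.inr b) (Or.inr rfl) z κ hκ m Λ hΛ hfr hmo⟩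

/-- The momentum instance `c = inr b` of (RW₁ᶜ) with (MC∞)✓ already gives the momentum duals
(SD₁) `DensityScoreDualBoundFirst` (tree junction `densityScoreDualBoundFirst_of_gram`).
[folklore] -/
theorem densityScoreDualBoundFirst_of_coord (h : GramControlledWeightMomentsCoord) :
    DensityScoreDualBoundFirst :=
  densityScoreDualBoundFirst_of_gram skeletonGramLimitInverseMoments_proved
    (gramControlledWeightMoments_of_coord h)

end Summit.AtomisticToContinuum.FouriersLaw.Theorems.ExtensiveSnapshotIrreversibility.EnergyWindow

end
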